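import Summits.Ventures.GridStability.Bench.CARACAS141DVOCSharpData
import HarnessLib

/-!
# CARACAS141DVOCSharp — T-L2b instance: the DECIDES (columns in range, symmetry, clique-sum sweep, block LDLᵀ) and the certified
connectivity constant for the data of `CARACAS141DVOCSharpData.lean` (see its header for the graph, λ, sizes and heights). [folklore]
-/

namespace Summit.Ventures.GridStability.Bench.CARACAS141DVOCSharp

open Literature.Computation.Certificates Literature.Computation.Certificates.PSD
open Literature.MathematicalPhysics.PowerSystems Summit.Ventures.GridStability.Lyapunov

/-- Every stored column index is a node (`< 141`). [folklore] -/
theorem cols : colsBelow 141 W = true := by decide +kernel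

/-- The weights are symmetric: ONE sparse check against the radix transpose (`d = 8`). [folklore] -/
theorem symm : SMat.eqCheck 141 W (SMat.transpose 8 141 W) = true := by decide +kernel

/-- The rank-one NEGATIVE term split off at the single negative pivot (node 5): `p`. [folklore] -/
def p : ℚ := ((-3782252960949876563 : ℚ) / 85899345920000000)

/-- The sparse rank-one column `u = ℓ_a` (support = the clique of the negative pivot). [folklore] -/
def us : SRow ℚ := [(5, (1 : ℚ)), (6, ((17094222115869032448 : ℚ) / 3782252960949876563))]

/-- `u` has in-range columns. [folklore] -/
theorem usCols : (us.all fun q => decide (q.1 < 141)) = true := by decide +kernel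

/-- `Σ uᵢ ≠ 0`. [folklore] -/
theorem usum : srowTotal us ≠ 0 := by decide +kernel

/-- The SHARP certificate's two kernel checks in ONE decide: the clique-sum identity `L − λI − p·uuᵀ = Σ_c P_cᵀ S_c P_c` for the rows
COMPUTED by `sharpSMat`, and every clique block PSD by in-kernel exact `LDLᵀ`. [folklore] -/
theorem sharpCert :
    cliqueSweepS 141 0 141 (sharpSMat 141 W lam p us) blocks = true ∧ ldlAll blocks = true := by
  decide +kernel

/-- **SHARP CERTIFIED CONNECTIVITY CONSTANT** `λ = 45489/131072` (up to `λ₂`, no grounding loss): `∀ z, λ·‖Hz‖₂² ≤ 141·½ΣΣ wᵢⱼ(zᵢ − zⱼ)²` for the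
rational weights `matrixOfSparseRows 141 141 W`. [folklore] -/
theorem connectivity_certificate :
    ∀ z : Fin 141 → ℝ, (lam : ℝ) * pairNormSq z
      ≤ ((140 + 1 : ℕ) : ℝ) * (1 / 2 * ∑ i, ∑ j, ((matrixOfSparseRows 141 141 W i j : ℚ) : ℝ) * (z i - z j) ^ 2) :=
  sharp_connectivity_certificate_of_smat (d := 8) W (by norm_num) cols symm lam (by norm_num [lam]) p us usCols usum blocks sharpCert.1 sharpCert.2

/-- Every bracket is a LOWER bracket of the real admittance (ONE decide). [folklore] -/
theorem lower : lowerCheck ZW = true := by decide +kernel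

/-- **SHARP CERTIFIED CONNECTIVITY CONSTANT for the REAL admittance weights** `‖Yᵢⱼ‖ = (rᵢⱼ² + xᵢⱼ²)^{-1/2}` (`λ = 45489/131072`). [folklore] -/
theorem connectivity_certificate_admittance_weights :
    ∀ z : Fin 141 → ℝ, (lam : ℝ) * pairNormSq z
      ≤ ((140 + 1 : ℕ) : ℝ) * (1 / 2 * ∑ i, ∑ j, admittanceKernel 141 ZW i j * (z i - z j) ^ 2) :=
  sharp_connectivity_certificate_admittance (d := 8) ZW lower (by norm_num) cols symm lam (by norm_num [lam]) p us usCols usum blocks sharpCert.1 sharpCert.2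

end Summit.Ventures.GridStability.Bench.CARACAS141DVOCSharp
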